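import Summits.BirchSwinnertonDyer.Rank1Residual.X5.TwoAdicTargetsMultAuto
import Summits.BirchSwinnertonDyer.Rank1Residual.X5.TwoAdicTargetsMultKatoRat
import Summits.BirchSwinnertonDyer.Rank1Residual.X5.TwoAdicTargetsMultConverse
import Summits.BirchSwinnertonDyer.Rank1Residual.X5.TwoAdicTargetsMultKatoInt
import Summits.BirchSwinnertonDyer.Rank1Residual.X5.TwoAdicTargetsMultPubOdd
import HarnessLib

/-!
# O1 (X5 at `p = 2`, non-CM): the MULT doors with the PRINT binder `h41` on the GUARDED twin of
# Greenberg's "analogue of theorem 4.1" — part A (Kato-⊗ℚ / auto-`hint` / converse / integral-Kato doors)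

HONEST FRAMING (cell `b2b-bsdres` / `bsd-2adic`, verbatim in every file): the goal of the cell is to
DELETE the COMBINATION-SHAPED residual classes of the Birch–Swinnerton-Dyer formula for ALL
analytic-rank `≤ 1` elliptic curves over `ℚ` — assembled STRICTLY from published theorems — so that the
rank-`≤ 1` remainder becomes exactly the CONSTRUCTION-SHAPED classes, which are TYPED, NOT attempted.
This is not "finishing BSD". Research routes; no claim beyond stated classes; nothing here is booked.

Unit `bsd-2adic-mult` (GEN 7). WHY THIS FILE EXISTS. The D-audit of the mult doors' PRINT binder `h41`
(`HOME/audit/D-AUDIT-h41-Gr99-Thm41-mult-analogue-at-2.md` @f526883ecb786716, 2026-08-26) found that the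
parity-free transcription `Greenberg1999.thm41Analogue_charValue_rankZero_numberField_anyPrime` (cell
registry A235), read as a `∀`-number-field `Prop`, is CONTRADICTED on print's own §3-Note sub-case (a
place `v ∣ 2` of even local degree, e.g. `F = ℚ(√10)`: `ker d_v = H¹(Γ_v,(ℚ₂/ℤ₂)(φ)) = 0`, so `l_v ≤ 1`,
not the displayed `2`), so no class can be worded PROVED-by-name on a theorem displaying `(h41 : A235)`.
The literature seat landed the GUARDED twin `Greenberg1999.thm41Analogue_charValue_rankZero_numberField_anyPrime_oddLocalDegree`
(p425330: A235 + «`p = 2` → every multiplicative `v ∋ 2` has odd local degree», print's generic case;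
over `ℚ` automatic) with PROVED projections whose `F = ℚ` statements are IDENTICAL to A235's; the O1
glue on the twin is `twoAdicEulerCharRankZeroNonsplitMult_zero_of_greenberg'`
(`X5/TwoAdicTargetsMultPubOdd.lean`, p428013). Every mult door consumed `h41` ONLY through that glue, so
each door below is the tree door of the same name without the prime, with (i) the binder `h41` re-typed
to the twin, (ii) the glue / inner doors replaced by their primed versions — hypotheses otherwise and
conclusions BYTE-IDENTICAL, proofs identical. LEAF module: the unprimed doors and their ~930 importers are
untouched (append-only tree, no rebuild cascade); the primed instance theorems
(`X5/TwoAdicInstancesTwin*.lean`) import this file. The split-multiplicative binder `h41sp`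
(A236 `….thm41Analogue_charValue_rankZero_split_baseChange_anyPrime`) PASSED the audit (V3) and is not
touched. Nothing is minted here (0 defs); nothing is booked; no count of record moves.

Sources: Greenberg, LNM 1716 (1999) §4 pp. 112–113 with §3 and Props. 4.14/5.14 (held copy
`book:coates1999-arithmetic-theory-elliptic-curves`); Mazur–Tate–Teitelbaum, Invent. math. 84 (1986)
§I.10/§I.14; Miller, LMS J. Comput. Math. 14 (2011) Def. 1.1; the memos of record named in the unprimed
doors' docstrings (HOME/mult/PROOF-MULT.md, PROOF-GVMULT.md, PROOF-TWIST.md, PROOF-LAMBDA2.md,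
PROOF-KATO2MULT.md). Design choice: one module per door family group (≤ 400 lines), theorem order = tree order.
-/

noncomputable section

open scoped Classical MatrixGroups ModularForm

open CongruenceSubgroup WeierstrassCurve Literature.NumberTheory.EllipticCurves
  Literature.NumberTheory.EllipticCurves.ModularForms
  Literature.NumberTheory.EllipticCurves.Wuthrich2014
  Literature.NumberTheory.EllipticCurves.Rank1Residual
  Literature.NumberTheory.EllipticCurves.Rank1Residual.Typed
  Literature.NumberTheory.EllipticCurves.Greenberg1999
  Literature.NumberTheory.Transcendental
  Summit.BirchSwinnertonDyer.Rank1Residual.X1.MuLambda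
  Summit.BirchSwinnertonDyer.Rank1Residual.X1.MuPart
  Summit.BirchSwinnertonDyer.Rank1Residual.X1.ParitySqueeze

set_option autoImplicit false

namespace Summit.BirchSwinnertonDyer.Rank1Residual.X5.O1

variable (W : WeierstrassCurve ℚ) [W.IsElliptic] [W.IsGloballyMinimal]

/-- **PRIMED (D-audit h41, 2026-08-26): the PRINT binder `h41` is re-typed from the parity-free transcription A235 to its GUARDED twin `Greenberg1999.thm41Analogue_charValue_rankZero_numberField_anyPrime_oddLocalDegree` (p425330); statement otherwise and conclusion byte-identical to `bsdp_two_nonsplit_of_mu_eq_zero_of_lowerBound_auto`, proof term identical with the primed glue/doors.** **The general non-split END-STATE per pair from a `μ = 0` certificate, control slot PUBLISHED and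
`hint` DISCHARGED (PROVED):** `BSDp W 2` ⟸ PRINT {Greenberg's non-split display at `2` (`h41`),
modularity, GZK} + K11a + `hμ` + `hper₀` + `hlow`. The O1-A-ns line (E[2] irreducible, where Prop. 5.14
does not apply and `hμ` is a tower-gap certificate). [cite: Miller2011LMS, Def. 1.1 and §1]
[cite: GreenbergLNM1716, §4 pp. 112–113] [cite: MazurTateTeitelbaum1986Invent, §I.12] -/
theorem bsdp_two_nonsplit_of_mu_eq_zero_of_lowerBound_auto'
    (h41 : thm41Analogue_charValue_rankZero_numberField_anyPrime_oddLocalDegree)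
    (hmod : nonempty_modularParametrizationData)
    (hGZK : rank_eq_analyticRank_of_analyticRank_le_one)
    (hK : ∀ [NeZero (W.conductorNorm ℤ)] (f : CuspForm (Gamma0 (W.conductorNorm ℤ)) 2)
      (L : PowerSeries ℚ_[2]), KatoDivisibilityAtTwoNonsplitMultRat W f L)
    (hμ : ∀ (κ : ZpExtension ℚ 2) (γ : Field.absoluteGaloisGroup ℚ), κ.IsCyclotomic →
      κ.IsTopGenerator γ → IsCyclotomicVariable 2 γ → ∀ D : W.SelmerDualData κ γ, D.mu = 0)
    (hper₀ : ∀ [NeZero (W.conductorNorm ℤ)] (f : CuspForm (Gamma0 (W.conductorNorm ℤ)) 2),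
      IsNewformOf W f → ∀ ϖ : ℚ, (ϖ : ℝ) * W.realPeriodRat = plusPeriod f → 0 ≤ padicValRat 2 ϖ)
    (hr : W.analyticRank = 0) (hmult : Mult W 2)
    (hns : ¬ W.HasSplitMultiplicativeReductionAtPrime 2) (hlow : MissingLowerBoundAt W 2) :
    BSDp W 2 :=
  bsdp_of_missingPPartAt W 2 hGZK (by rw [hr]; exact zero_le_one)
    (missingPPartAt_of_lower_of_upper W 2 hlow
      (missingUpperBoundAt_two_nonsplit_of_mu_eq_zero_auto W
        (twoAdicEulerCharRankZeroNonsplitMult_zero_of_greenberg' W h41) hmod hGZK hK hμ hper₀ hr hmult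
        hns))

/-- **PRIMED (D-audit h41, 2026-08-26): the PRINT binder `h41` is re-typed from the parity-free transcription A235 to its GUARDED twin `Greenberg1999.thm41Analogue_charValue_rankZero_numberField_anyPrime_oddLocalDegree` (p425330); statement otherwise and conclusion byte-identical to `bsdp_two_nonsplit_of_prop514_of_lowerBound_auto`, proof term identical with the primed glue/doors.** **α-ns END-STATE per pair with the control slot PUBLISHED and the integrality certificate
DISCHARGED: `BSD(E,2)` on the Prop. 5.14 locus at a non-split multiplicative `2` from the lower half
(PROVED).** Per pair the inputs are PRINT {Prop. 5.14 at `2` (`h514`), Greenberg's non-split display at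
`2` (`h41`), modularity (`hmod`), GZK (`hGZK`)} + K11a (`hK`, NOT in print; price AUDIT S–M) + the
decidable 5.14 data (`hP`, `h2`, `hΦ`) + two per-pair inputs {`hper₀` (`0 ≤ ord₂(Ω⁺_f/Ω_W)`), `hlow`
(`MissingLowerBoundAt W 2`)}. One member per isogeny class suffices (`bsdp_two_iff_of_isIsogenous`).
Nothing is booked. [cite: GreenbergLNM1716, Prop. 5.14 (p. 121) and §4 pp. 112–113]
[cite: Miller2011LMS, Def. 1.1 and §1] [cite: MazurTateTeitelbaum1986Invent, §I.12] -/
theorem bsdp_two_nonsplit_of_prop514_of_lowerBound_auto'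
    (h514 : prop514_isTorsion_mu_eq_zero_two)
    (h41 : thm41Analogue_charValue_rankZero_numberField_anyPrime_oddLocalDegree)
    (hmod : nonempty_modularParametrizationData)
    (hGZK : rank_eq_analyticRank_of_analyticRank_le_one)
    (hK : ∀ [NeZero (W.conductorNorm ℤ)] (f : CuspForm (Gamma0 (W.conductorNorm ℤ)) 2)
      (L : PowerSeries ℚ_[2]), KatoDivisibilityAtTwoNonsplitMultRat W f L)
    (hper₀ : ∀ [NeZero (W.conductorNorm ℤ)] (f : CuspForm (Gamma0 (W.conductorNorm ℤ)) 2),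
      IsNewformOf W f → ∀ ϖ : ℚ, (ϖ : ℝ) * W.realPeriodRat = plusPeriod f → 0 ≤ padicValRat 2 ϖ)
    (hr : W.analyticRank = 0) (hmult : Mult W 2) (hns : ¬ W.HasSplitMultiplicativeReductionAtPrime 2)
    {x y : ℚ} (hP : W.toAffine.Equation x y) (h2 : 2 * y + W.a₁ * x + W.a₃ = 0)
    (hΦ : (TwoTorsionRamifiedAtTwo x ∧ ¬ TwoTorsionOdd W x) ∨
      (TwoTorsionOdd W x ∧ ¬ TwoTorsionRamifiedAtTwo x))
    (hlow : MissingLowerBoundAt W 2) : BSDp W 2 :=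
  bsdp_of_missingPPartAt W 2 hGZK (by rw [hr]; exact zero_le_one)
    (missingPPartAt_of_lower_of_upper W 2 hlow
      (missingUpperBoundAt_two_nonsplit_of_prop514_auto W h514
        (twoAdicEulerCharRankZeroNonsplitMult_zero_of_greenberg' W h41) hmod hGZK hK hper₀ hr hmult
        hns hP h2 hΦ))

/-- **PRIMED (D-audit h41, 2026-08-26): the PRINT binder `h41` is re-typed from the parity-free transcription A235 to its GUARDED twin `Greenberg1999.thm41Analogue_charValue_rankZero_numberField_anyPrime_oddLocalDegree` (p425330); statement otherwise and conclusion byte-identical to `bsdp_two_nonsplit_of_prop514_of_lowerBound_of_multRat`, proof term identical with the primed glue/doors.** **α-ns END-STATE per pair from the prime-uniform binder (PROVED):** at a NON-SPLIT multiplicative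
`2`, analytic rank `0`, on the Prop. 5.14 locus: `BSDp W 2` ⟸ PRINT {`h514`, `h41`, modularity, GZK}
+ `KatoMultiplicativeDivisibilityRat W 2` + the decidable 5.14 data + `hper₀` + `hlow`
(`bsdp_two_nonsplit_of_prop514_of_lowerBound_auto` with `hK` supplied by
`katoDivisibilityAtTwoNonsplitMultRat_of_multRat`). [cite: GreenbergLNM1716, Prop. 5.14 (p. 121) and §4 pp. 112–113]
[cite: Miller2011LMS, Def. 1.1 and §1] -/
theorem bsdp_two_nonsplit_of_prop514_of_lowerBound_of_multRat'
    (hKato : KatoMultiplicativeDivisibilityRat W 2)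
    (h514 : prop514_isTorsion_mu_eq_zero_two)
    (h41 : thm41Analogue_charValue_rankZero_numberField_anyPrime_oddLocalDegree)
    (hmod : nonempty_modularParametrizationData)
    (hGZK : rank_eq_analyticRank_of_analyticRank_le_one)
    (hper₀ : ∀ [NeZero (W.conductorNorm ℤ)] (f : CuspForm (Gamma0 (W.conductorNorm ℤ)) 2),
      IsNewformOf W f → ∀ ϖ : ℚ, (ϖ : ℝ) * W.realPeriodRat = plusPeriod f → 0 ≤ padicValRat 2 ϖ)
    (hr : W.analyticRank = 0) (hmult : Mult W 2) (hns : ¬ W.HasSplitMultiplicativeReductionAtPrime 2)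
    {x y : ℚ} (hP : W.toAffine.Equation x y) (h2 : 2 * y + W.a₁ * x + W.a₃ = 0)
    (hΦ : (TwoTorsionRamifiedAtTwo x ∧ ¬ TwoTorsionOdd W x) ∨
      (TwoTorsionOdd W x ∧ ¬ TwoTorsionRamifiedAtTwo x))
    (hlow : MissingLowerBoundAt W 2) : BSDp W 2 :=
  bsdp_two_nonsplit_of_prop514_of_lowerBound_auto' W h514 h41 hmod hGZK
    (fun f L => katoDivisibilityAtTwoNonsplitMultRat_of_multRat W hKato f L) hper₀ hr hmult hns hP
    h2 hΦ hlow

/-- **PRIMED (D-audit h41, 2026-08-26): the PRINT binder `h41` is re-typed from the parity-free transcription A235 to its GUARDED twin `Greenberg1999.thm41Analogue_charValue_rankZero_numberField_anyPrime_oddLocalDegree` (p425330); statement otherwise and conclusion byte-identical to `bsdp_two_nonsplit_of_mu_eq_zero_of_lowerBound_of_multRat`, proof term identical with the primed glue/doors.** **O1-A-ns END-STATE per pair from the prime-uniform binder and a `μ = 0` certificate (PROVED):**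
non-split multiplicative `2`, analytic rank `0`: `BSDp W 2` ⟸ PRINT {`h41`, modularity, GZK} +
`KatoMultiplicativeDivisibilityRat W 2` + `hμ` + `hper₀` + `hlow`
(`bsdp_two_nonsplit_of_mu_eq_zero_of_lowerBound_auto`). [cite: GreenbergLNM1716, §4 pp. 112–113]
[cite: Miller2011LMS, Def. 1.1 and §1] -/
theorem bsdp_two_nonsplit_of_mu_eq_zero_of_lowerBound_of_multRat'
    (hKato : KatoMultiplicativeDivisibilityRat W 2)
    (h41 : thm41Analogue_charValue_rankZero_numberField_anyPrime_oddLocalDegree)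
    (hmod : nonempty_modularParametrizationData)
    (hGZK : rank_eq_analyticRank_of_analyticRank_le_one)
    (hμ : ∀ (κ : ZpExtension ℚ 2) (γ : Field.absoluteGaloisGroup ℚ), κ.IsCyclotomic →
      κ.IsTopGenerator γ → IsCyclotomicVariable 2 γ → ∀ D : W.SelmerDualData κ γ, D.mu = 0)
    (hper₀ : ∀ [NeZero (W.conductorNorm ℤ)] (f : CuspForm (Gamma0 (W.conductorNorm ℤ)) 2),
      IsNewformOf W f → ∀ ϖ : ℚ, (ϖ : ℝ) * W.realPeriodRat = plusPeriod f → 0 ≤ padicValRat 2 ϖ)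
    (hr : W.analyticRank = 0) (hmult : Mult W 2) (hns : ¬ W.HasSplitMultiplicativeReductionAtPrime 2)
    (hlow : MissingLowerBoundAt W 2) : BSDp W 2 :=
  bsdp_two_nonsplit_of_mu_eq_zero_of_lowerBound_auto' W h41 hmod hGZK
    (fun f L => katoDivisibilityAtTwoNonsplitMultRat_of_multRat W hKato f L) hμ hper₀ hr hmult hns
    hlow

/-- **PRIMED (D-audit h41, 2026-08-26): the PRINT binder `h41` is re-typed from the parity-free transcription A235 to its GUARDED twin `Greenberg1999.thm41Analogue_charValue_rankZero_numberField_anyPrime_oddLocalDegree` (p425330); statement otherwise and conclusion byte-identical to `analyticRank_eq_zero_of_finite_selmer_nonsplit_two`, proof term identical with the primed glue/doors.** **Rank-`0` `2`-converse at a non-split multiplicative `2` (PROVED modulo the typed input).**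
`E/ℚ` (globally minimal `W`) non-split multiplicative at `2`; inputs: Greenberg's non-split display at
`2` (`h41`, A235, PRINT), modularity (`hmod`, PRINT), K11a for the newform at level `N_E` (`hK`; the
seat's PROOF-MULT Thm. A — only `X` torsion is used), and T-mult-4 (`hlow'`). If `Sel_{2^∞}(E/ℚ)` is
finite then `L(E,1) ≠ 0` and `r_an(E) = 0`: A235 gives
`f_E(0)·#E(ℚ)[2^∞]² = u·2^{ord₂∏c+1}·#Sel ≠ 0`, T-mult-4 gives `2ⁿ f_E(0) = h(0)·L(0)`, so
`L(0) = 2·[0]⁺_f ≠ 0`, i.e. `L(E,1) = [0]⁺_f·Ω⁺_f ≠ 0`. [cite: GreenbergLNM1716, §4 pp. 112–113]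
[cite: MazurTateTeitelbaum1986Invent, §I.14 (L(0) = (1 − α⁻¹)[0]⁺, α = −1)] -/
theorem analyticRank_eq_zero_of_finite_selmer_nonsplit_two'
    (h41 : thm41Analogue_charValue_rankZero_numberField_anyPrime_oddLocalDegree)
    (hmod : nonempty_modularParametrizationData)
    (hK : ∀ [NeZero (W.conductorNorm ℤ)] (f : CuspForm (Gamma0 (W.conductorNorm ℤ)) 2)
      (L : PowerSeries ℚ_[2]), KatoDivisibilityAtTwoNonsplitMultRat W f L)
    (hlow' : MultLowerDivisibilityAtTwoRat W)
    (hmult : Mult W 2) (hns : ¬ W.HasSplitMultiplicativeReductionAtPrime 2)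
    (hfin : Finite (W.selmerGroupPInfty 2)) :
    W.entireLFunction 1 ≠ 0 ∧ W.analyticRank = 0 := by
  haveI : NeZero (W.conductorNorm ℤ) := ⟨(W.conductorNorm_pos_holds).ne'⟩
  obtain ⟨Dm⟩ := hmod W
  have hf : IsNewformOf W Dm.f := Dm.isNewformOf
  obtain ⟨κ, hκ, γ, hγ, hγ'⟩ := exists_isCyclotomic_isTopGenerator_isCyclotomicVariable_holds 2
  obtain ⟨D⟩ := W.nonempty_selmerDualData_holds κ γ hγ
  obtain ⟨L, hL⟩ := exists_isMultPAdicLFunctionOf_neg_one_of_nonsplit (p := 2) hf hmult hns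
  obtain ⟨hX, -⟩ := hK Dm.f L κ γ hκ hγ hγ' hmult hns hf hL D
  haveI : Module.Finite (IwasawaAlgebra 2) D.X := D.module_finite_holds hγ
  haveI : (Module.charIdeal (IwasawaAlgebra 2) D.X).IsPrincipal := charIdeal_isPrincipal_holds 2 D.X
  obtain ⟨fE, hchar⟩ := Submodule.IsPrincipal.principal (Module.charIdeal (IwasawaAlgebra 2) D.X)
  have hchar' : D.charIdeal = Ideal.span {fE} := hchar
  -- Greenberg's non-split display at `2` (A235): `f_E(0) ≠ 0` since `Sel` is finite
  have hEC : TwoAdicEulerCharRankZeroNonsplitMult W 0 :=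
    twoAdicEulerCharRankZeroNonsplitMult_zero_of_greenberg' W h41
  obtain ⟨u, hu⟩ := hEC hmult hns κ γ hκ hγ hγ' D hX fE hchar' hfin
  have hcard : (Nat.card (W.selmerGroupPInfty 2) : ℚ_[2]) ≠ 0 := by
    haveI := hfin
    exact_mod_cast (Nat.card_pos (α := W.selmerGroupPInfty 2)).ne'
  have hfE0 : ((PowerSeries.constantCoeff fE : ℤ_[2]) : ℚ_[2]) ≠ 0 := by
    intro h0
    rw [h0, zero_mul] at hu
    exact (mul_ne_zero (mul_ne_zero (coe_units_ne_zero 2 u) (zpow_ne_zero _ two_ne_zero)) hcard)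
      hu.symm
  -- T-mult-4, non-split clause: `2ⁿ · ι f_E = ι h · L`, constant coefficients
  obtain ⟨hns', -⟩ := hlow' κ γ hκ hγ hγ' hmult Dm.f hf D fE hchar'
  obtain ⟨n, h, hdiv⟩ := hns' hns L hL
  have h0 := congrArg PowerSeries.constantCoeff hdiv
  rw [map_mul, map_mul, PowerSeries.constantCoeff_C, constantCoeff_iwasawaToPowerSeries,
    constantCoeff_iwasawaToPowerSeries, hL.constantCoeff_of_neg_one] at h0
  -- `2ⁿ · f_E(0) = h(0) · (2 · [0]⁺_f)`, so `[0]⁺_f ≠ 0`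
  have hs0 : (ratPlusSymbol Dm.f 0 : ℚ_[2]) ≠ 0 := by
    intro hz
    rw [hz, mul_zero, mul_zero] at h0
    exact (mul_ne_zero (pow_ne_zero n two_ne_zero) hfE0) h0
  have hs0' : ratPlusSymbol Dm.f 0 ≠ 0 := by exact_mod_cast hs0
  have hL1 : W.entireLFunction 1 ≠ 0 := (ratPlusSymbol_zero_ne_zero_iff W hf).mp hs0'
  exact ⟨hL1, (W.analyticRank_eq_zero_iff_holds hf.hasEntireLFunction).mpr hL1⟩

/-- **PRIMED (D-audit h41, 2026-08-26): the PRINT binder `h41` is re-typed from the parity-free transcription A235 to its GUARDED twin `Greenberg1999.thm41Analogue_charValue_rankZero_numberField_anyPrime_oddLocalDegree` (p425330); statement otherwise and conclusion byte-identical to `bsdp_two_nonsplit_of_katoIntPinch`, proof term identical with the primed glue/doors.** **DOOR (34-INT-pinch), non-split `E` with `E[2]` irreducible (PROVED modulo the displayed inputs):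
`BSDp W 2`, both halves.** Binders: PRINT {A235 `h41`, modularity `hmod`, GZK}; MEMO {T-KATO2-NSMULT
`hKint` (PROOF-KATO2MULT Thm. A), the Selmer `λ`-lower-bound `hlow` (ibid. §6.2 on Greenberg 4.14)};
CERTIFICATES {`λ_an(E) = n` (`hlan`), `μ_an(E) = 0` (`hμan`) — GEN-3 engine at level 6}; the curve's
own decidable data {`Mult W 2`, non-split, `TwoAdicSurjective W`, `Δ < 0`}; `hper₀`; analytic rank `0`.
No reference, no `2`-torsion point, no `μ`-input. Chain: `hKint` ⇒ `X` torsion ∧ `L₀ ∈ char X`;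
`charIdeal_eq_span_of_katoInt_selmerPinch_nonsplit` ⇒ `char X = (L₀)`;
`missingPPartAt_two_nonsplit_of_charIdeal_eq_span` (A235: the `l_v = 2` cancels MTT's `(1 − α⁻¹) = 2`)
⇒ `ord₂ #Ш_an = ord₂ #Ш`; `bsdp_of_missingPPartAt`. [cite: GreenbergLNM1716, §4 pp. 112–113 and Prop. 4.14 (p. 124)]
[cite: MazurTateTeitelbaum1986Invent, §I.14 (L(0) = (1 − α⁻¹)[0]⁺, α = −1)] [cite: Miller2011LMS, Def. 1.1 and §1] -/
theorem bsdp_two_nonsplit_of_katoIntPinch' {n : ℕ}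
    (h41 : thm41Analogue_charValue_rankZero_numberField_anyPrime_oddLocalDegree)
    (hmod : nonempty_modularParametrizationData)
    (hGZK : rank_eq_analyticRank_of_analyticRank_le_one)
    (hKint : KatoDivisibilityAtTwoNonsplitMultInt W) (hlow : SelmerLambdaLowerBoundAtTwo W n)
    (hper₀ : ∀ [NeZero (W.conductorNorm ℤ)] (f : CuspForm (Gamma0 (W.conductorNorm ℤ)) 2),
      IsNewformOf W f → ∀ ϖ : ℚ, (ϖ : ℝ) * W.realPeriodRat = plusPeriod f → 0 ≤ padicValRat 2 ϖ)
    (hr : W.analyticRank = 0) (hmult : Mult W 2) (hns : ¬ W.HasSplitMultiplicativeReductionAtPrime 2)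
    (him : TwoAdicSurjective W) (hΔ : W.Δ < 0)
    (hlan : X2.AnalyticLambdaEq W 2 n) (hμan : X2.AnalyticMuLE W 2 0) : BSDp W 2 := by
  haveI : NeZero (W.conductorNorm ℤ) := ⟨(W.conductorNorm_pos_holds).ne'⟩
  obtain ⟨Dm⟩ := hmod W
  have hf : IsNewformOf W Dm.f := Dm.isNewformOf
  have hL : W.entireLFunction 1 ≠ 0 :=
    (W.analyticRank_eq_zero_iff_holds hf.hasEntireLFunction).mp hr
  obtain ⟨ϖ, -, hϖ, -⟩ := Dm.exists_rat_mul_realPeriodRat_eq_plusPeriod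
  obtain ⟨κ, hκ, γ, hγ, hγ'⟩ := exists_isCyclotomic_isTopGenerator_isCyclotomicVariable_holds 2
  obtain ⟨DW⟩ := W.nonempty_selmerDualData_holds κ γ hγ
  obtain ⟨L, hLf⟩ := exists_isMultPAdicLFunctionOf_neg_one_of_nonsplit hf hmult hns
  obtain ⟨L₀, hL₀⟩ := exists_iwasawaToPowerSeries_eq_C_mul_of_isMultPAdicLFunctionOf_neg_one_two hf
    hmult hns (hper₀ Dm.f hf ϖ hϖ) hLf
  obtain ⟨hX, hKL₀⟩ := hKint hmult hns him hΔ Dm.f hf L hLf κ γ hκ hγ hγ' DW ϖ hϖ L₀ hL₀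
  have hchar := charIdeal_eq_span_of_katoInt_selmerPinch_nonsplit W hns hlan hμan hκ hγ hγ' hf hLf DW
    hX hϖ hL₀ hKL₀ hlow
  exact bsdp_of_missingPPartAt W 2 hGZK (by rw [hr]; exact zero_le_one)
    (missingPPartAt_two_nonsplit_of_charIdeal_eq_span W
      (twoAdicEulerCharRankZeroNonsplitMult_zero_of_greenberg' W h41) hGZK hmult hns hL hκ hγ hγ' hf hLf
      DW hX hϖ hL₀ hchar)

/-- **PRIMED (D-audit h41, 2026-08-26): the PRINT binder `h41` is re-typed from the parity-free transcription A235 to its GUARDED twin `Greenberg1999.thm41Analogue_charValue_rankZero_numberField_anyPrime_oddLocalDegree` (p425330); statement otherwise and conclusion byte-identical to `analyticRank_eq_zero_of_finite_selmer_of_katoIntPinch`, proof term identical with the primed glue/doors.** **DOOR (34-INT-pinch), non-split `E` with `E[2]` irreducible, CONVERSE FORM (PROVED modulo the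
displayed inputs):** with the same inputs MINUS analytic rank `0` and GZK, `Sel_{2^∞}(E/ℚ)` finite
⇒ `L(E,1) ≠ 0 ∧ r_an(E) = 0`. [cite: GreenbergLNM1716, §4 pp. 112–113 and Prop. 4.14 (p. 124)]
[cite: MazurTateTeitelbaum1986Invent, §I.14] -/
theorem analyticRank_eq_zero_of_finite_selmer_of_katoIntPinch' {n : ℕ}
    (h41 : thm41Analogue_charValue_rankZero_numberField_anyPrime_oddLocalDegree)
    (hmod : nonempty_modularParametrizationData)
    (hKint : KatoDivisibilityAtTwoNonsplitMultInt W) (hlow : SelmerLambdaLowerBoundAtTwo W n)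
    (hper₀ : ∀ [NeZero (W.conductorNorm ℤ)] (f : CuspForm (Gamma0 (W.conductorNorm ℤ)) 2),
      IsNewformOf W f → ∀ ϖ : ℚ, (ϖ : ℝ) * W.realPeriodRat = plusPeriod f → 0 ≤ padicValRat 2 ϖ)
    (hmult : Mult W 2) (hns : ¬ W.HasSplitMultiplicativeReductionAtPrime 2)
    (him : TwoAdicSurjective W) (hΔ : W.Δ < 0)
    (hlan : X2.AnalyticLambdaEq W 2 n) (hμan : X2.AnalyticMuLE W 2 0)
    (hfin : Finite (W.selmerGroupPInfty 2)) : W.entireLFunction 1 ≠ 0 ∧ W.analyticRank = 0 := by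
  haveI : NeZero (W.conductorNorm ℤ) := ⟨(W.conductorNorm_pos_holds).ne'⟩
  obtain ⟨Dm⟩ := hmod W
  have hf : IsNewformOf W Dm.f := Dm.isNewformOf
  obtain ⟨ϖ, -, hϖ, -⟩ := Dm.exists_rat_mul_realPeriodRat_eq_plusPeriod
  obtain ⟨κ, hκ, γ, hγ, hγ'⟩ := exists_isCyclotomic_isTopGenerator_isCyclotomicVariable_holds 2
  obtain ⟨DW⟩ := W.nonempty_selmerDualData_holds κ γ hγ
  obtain ⟨L, hLf⟩ := exists_isMultPAdicLFunctionOf_neg_one_of_nonsplit hf hmult hns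
  obtain ⟨L₀, hL₀⟩ := exists_iwasawaToPowerSeries_eq_C_mul_of_isMultPAdicLFunctionOf_neg_one_two hf
    hmult hns (hper₀ Dm.f hf ϖ hϖ) hLf
  obtain ⟨hX, hKL₀⟩ := hKint hmult hns him hΔ Dm.f hf L hLf κ γ hκ hγ hγ' DW ϖ hϖ L₀ hL₀
  have hchar := charIdeal_eq_span_of_katoInt_selmerPinch_nonsplit W hns hlan hμan hκ hγ hγ' hf hLf DW
    hX hϖ hL₀ hKL₀ hlow
  exact entireLFunction_one_ne_zero_of_finite_selmer_of_charIdeal_eq_span_nonsplit W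
    (twoAdicEulerCharRankZeroNonsplitMult_zero_of_greenberg' W h41) hmult hns hκ hγ hγ' hf hLf DW hX hL₀
    hchar hfin

/-- **PRIMED (D-audit h41, 2026-08-26): the PRINT binder `h41` is re-typed from the parity-free transcription A235 to its GUARDED twin `Greenberg1999.thm41Analogue_charValue_rankZero_numberField_anyPrime_oddLocalDegree` (p425330); statement otherwise and conclusion byte-identical to `missingUpperBoundAt_two_nonsplit_of_katoInt`, proof term identical with the primed glue/doors.** **`MissingUpperBoundAt W 2` at a NON-SPLIT `2` for `E[2]` irreducible from T-KATO2-NSMULT ALONE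
(PROVED modulo the displayed inputs; SHARP, no `λ`/`μ` certificate, no Selmer bound).** Rank `0` (`hr`),
`Mult W 2`, non-split, `TwoAdicSurjective W`, `Δ < 0`; PRINT {A235 `h41`, `hmod`, `hGZK`}; MEMO {`hKint`};
the period datum `hper₀`. `hKint` gives `X` torsion and `L₀ ∈ char_Λ X` for `ι L₀ = ϖ·L`, and
`upperBound_two_nonsplit_of_divisibilityRat` (A235: `l_v = 2` cancels MTT's `2`) at `ϖ′ = ϖ`, `k = 0` gives
`ord₂ #Ш ≤ ord₂ #Ш_an`. This is the per-curve form of Theorem A's Corollary D(i) on the `Δ < 0` locus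
(814 surjective non-split classes of record). [cite: GreenbergLNM1716, §4 pp. 112–113]
[cite: MazurTateTeitelbaum1986Invent, §I.10 and §I.14] [cite: Miller2011LMS, Def. 1.1] -/
theorem missingUpperBoundAt_two_nonsplit_of_katoInt'
    (h41 : thm41Analogue_charValue_rankZero_numberField_anyPrime_oddLocalDegree)
    (hmod : nonempty_modularParametrizationData)
    (hGZK : rank_eq_analyticRank_of_analyticRank_le_one)
    (hKint : KatoDivisibilityAtTwoNonsplitMultInt W)
    (hper₀ : ∀ [NeZero (W.conductorNorm ℤ)] (f : CuspForm (Gamma0 (W.conductorNorm ℤ)) 2),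
      IsNewformOf W f → ∀ ϖ : ℚ, (ϖ : ℝ) * W.realPeriodRat = plusPeriod f → 0 ≤ padicValRat 2 ϖ)
    (hr : W.analyticRank = 0) (hmult : Mult W 2) (hns : ¬ W.HasSplitMultiplicativeReductionAtPrime 2)
    (him : TwoAdicSurjective W) (hΔ : W.Δ < 0) : MissingUpperBoundAt W 2 := by
  haveI : NeZero (W.conductorNorm ℤ) := ⟨(W.conductorNorm_pos_holds).ne'⟩
  obtain ⟨Dm⟩ := hmod W
  have hf : IsNewformOf W Dm.f := Dm.isNewformOf
  have hL : W.entireLFunction 1 ≠ 0 :=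
    (W.analyticRank_eq_zero_iff_holds hf.hasEntireLFunction).mp hr
  obtain ⟨ϖ, hϖpos, hϖeq, -⟩ := Dm.exists_rat_mul_realPeriodRat_eq_plusPeriod
  obtain ⟨κ, hκ, γ, hγ, hγ'⟩ := exists_isCyclotomic_isTopGenerator_isCyclotomicVariable_holds 2
  obtain ⟨D⟩ := W.nonempty_selmerDualData_holds κ γ hγ
  obtain ⟨L, hLf⟩ := exists_isMultPAdicLFunctionOf_neg_one_of_nonsplit hf hmult hns
  obtain ⟨L₀, hL₀⟩ := exists_iwasawaToPowerSeries_eq_C_mul_of_isMultPAdicLFunctionOf_neg_one_two hf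
    hmult hns (hper₀ Dm.f hf ϖ hϖeq) hLf
  obtain ⟨hX, hmem⟩ := hKint hmult hns him hΔ Dm.f hf L hLf κ γ hκ hγ hγ' D ϖ hϖeq L₀ hL₀
  obtain ⟨q, hq, hle⟩ := upperBound_two_nonsplit_of_divisibilityRat W
    (twoAdicEulerCharRankZeroNonsplitMult_zero_of_greenberg' W h41) hGZK hmult hns hL hκ hγ hγ'
    hf hLf D ϖ hϖeq hϖpos.ne' 0 (by simp) ⟨hX, L₀, hmem, hL₀⟩
  exact ⟨q, hq, by simpa using hle⟩

end Summit.BirchSwinnertonDyer.Rank1Residual.X5.O1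

end
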